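import Summits.RiemannHypothesis.RiemannHypothesis.Theorems.SignConeKreinTuranLowFreq
import Summits.RiemannHypothesis.RiemannHypothesis.Theorems.SignConeKreinTuranArchDensity

/-!
# Route SignCone — Krein–Turán rung, IV: Theorem A′ (Weil's functional with unit slack, Krein–Turán form)

Support for the crux `SignConeInequality` (stmt-RiemannHypothesis-16301; plan `Cruxes/SignConeInequality/KREIN-TURAN-RUNG.md` §2).
**Theorem A′.** Let every zero of `ζ` with `|Im ρ| ≤ H` lie on the critical line, `Θ ≥ Σ_{|Im ρ|>H} m(ρ)/(Im ρ)²`, let `A` be an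
arch density at cutoff `b′ ≥ b + 2(m+1)h` with `N′` honest nodes (`IsArchDensity`), `A ≥ Π + 1` for `|y| > Y` and `A ≥ −B` for
`|y| ≤ Y`, and let `Π` be a Krein–Turán bound for the honest comb on tests supported in `[-b′, b′]`. If
`τ′ + δ′ (B + Π + 1) ≤ 1` with `τ′ = 6 b e^b (cosh(h/2)/h)^{2(m+1)} H^{2−2(m+1)} Θ`, `δ′ = ((m+1)(hY)²/3)²` (and `cosh(h/2) ≤ hH`,
`hY ≤ 1`), then `0 ≤ Re W(g ⋆ g̃) + ‖g‖₂²` for every Weil test `g` supported in `[-b, b]` (`unitSlackWeil_of_rhUpTo_kreinTuran`).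
Proof (split the TEST, not the density): `v = g − g ⋆ φ` (`φ = crMoll h m`), `V = v ⋆ ṽ`, `G = g ⋆ g̃`;
`v̂ = ĝ (1 − φ̂)`, `|v̂(½+iy)|² = |ĝ|² (1 − sinc(yh)^{2(m+1)})²`.
* zeros: `Re W(G) − Re W(V) ≥ −τ′‖g‖²` (`re_weilFunctional_sub_ge_of_rhUpTo`: on the line `Ĝ − V̂ = |ĝ|² φ̂(2 − φ̂) ≥ 0`, above
  height `H` `‖Ĝ − V̂‖ ≤ 2be^b‖g‖² · 3 (cosh(h/2)/(|γ|h))^{2(m+1)}` — ONE mollifier power);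
* arch side: `Re W(V) + ‖v‖² = (1/2π)∫|v̂|²A − Σ a_n Re V(log n) ≥ (1/2π)∫|v̂|²A − Π‖v‖²` (Krein–Turán);
* sum: `Re W(G) + ‖g‖² ≥ (1/2π)∫|ĝ|²[t A − (Π+1) t + 1 − τ′] ≥ 0` pointwise (`t = (1 − sinc^{2(m+1)})² ∈ [0,1]`, `t ≤ δ′` on `|y| ≤ Y`).
-/

noncomputable section

-- `Summit.RiemannHypothesis.RiemannHypothesis.…` repeats a namespace component by design (D-0017 layout).
set_option linter.dupNamespace false

open scoped BigOperators ComplexConjugate Real Topology ArithmeticFunction.vonMangoldt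
open Complex MeasureTheory Set Filter

namespace Summit.RiemannHypothesis.RiemannHypothesis.Theorems.SignCone

open Literature.NumberTheory.LFunctions
open Literature.NumberTheory.LFunctions.ZetaZeroTails (tailInvImSq tailInvImSq_nonneg)

section HighPart

variable {g : ℝ → ℂ} (hg : IsWeilTest g) {b : ℝ} (hb : 0 < b) (hsupp : tsupport g ⊆ Icc (-b) b)
  {h : ℝ} (hh : 0 < h) (m : ℕ)
include hg hh

/-- The high-frequency part `v = g − g ⋆ φ` of a Weil test is a Weil test. [folklore] -/
theorem isWeilTest_highPart : IsWeilTest (g + fun t => (-1) * weilConv g (crMoll h m) t) :=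
  hg.add ((isWeilTest_weilConv_crMoll hg hh m).const_mul (-1))

include hsupp in
/-- `tsupport (g − g ⋆ φ) ⊆ [-(b + 2(m+1)h), b + 2(m+1)h]`. [folklore] -/
theorem tsupport_highPart_subset :
    tsupport (g + fun t => (-1) * weilConv g (crMoll h m) t) ⊆ Icc (-(b + 2 * (m + 1) * h)) (b + 2 * (m + 1) * h) := by
  refine (tsupport_add g (fun t => (-1) * weilConv g (crMoll h m) t)).trans (union_subset ?_ ?_)
  · refine hsupp.trans (Icc_subset_Icc ?_ ?_) <;> nlinarith [hh, (by positivity : (0 : ℝ) ≤ 2 * (m + 1) * h)]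
  · exact tsupport_mul_subset_right.trans (tsupport_weilConv_crMoll_subset hg hsupp hh m)

/-- Transform of the high-frequency part: `v̂(s) = ĝ(s) (1 − sinhc((s−½)h)^{2(m+1)})`. [folklore] -/
theorem weilMellin_highPart (s : ℂ) :
    weilMellin (g + fun t => (-1) * weilConv g (crMoll h m) t) s =
      weilMellin g s * (1 - sinhc ((s - 1 / 2) * h) ^ (2 * (m + 1))) := by
  have hgL := isWeilTest_weilConv_crMoll hg hh m
  rw [weilMellin_add hg.1.continuous hg.2 (hgL.const_mul (-1)).1.continuous (hgL.const_mul (-1)).2,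
    weilMellin_const_mul, weilMellin_weilConv_crMoll hg hh m]
  ring

/-- On the critical line: `v̂(½+iy) = ĝ(½+iy) (1 − sinc(yh)^{2(m+1)})`. [folklore] -/
theorem weilMellin_highPart_half_line (y : ℝ) :
    weilMellin (g + fun t => (-1) * weilConv g (crMoll h m) t) (1 / 2 + y * I) =
      weilMellin g (1 / 2 + y * I) * (1 - ((Real.sinc (y * h) ^ (2 * (m + 1)) : ℝ) : ℂ)) := by
  rw [weilMellin_highPart hg hh m, show ((1 / 2 : ℂ) + y * I - 1 / 2) * h = ((y * h : ℝ) : ℂ) * I by push_cast; ring,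
    sinhc_mul_I]
  push_cast
  ring

/-- `|v̂(½+iy)|² = |ĝ(½+iy)|² (1 − sinc(yh)^{2(m+1)})²`. [folklore] -/
theorem norm_sq_weilMellin_highPart (y : ℝ) :
    ‖weilMellin (g + fun t => (-1) * weilConv g (crMoll h m) t) (1 / 2 + y * I)‖ ^ 2 =
      ‖weilMellin g (1 / 2 + y * I)‖ ^ 2 * (1 - Real.sinc (y * h) ^ (2 * (m + 1))) ^ 2 := by
  rw [weilMellin_highPart_half_line hg hh m, norm_mul, mul_pow, ← Complex.ofReal_one, ← Complex.ofReal_sub,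
    Complex.norm_real, Real.norm_eq_abs, sq_abs]

include hb hsupp in
/-- **Strip decay of `Ĝ − V̂`** at a point `ρ = β + iγ` of the open critical strip with `cosh(h/2) ≤ |γ| h`:
`‖Ĝ(ρ) − V̂(ρ)‖ ≤ 6 b e^b ‖g‖₂² (cosh(h/2)/h)^{2(m+1)} / |γ|^{2(m+1)}` (one mollifier power). [folklore] -/
theorem norm_weilMellin_quadratic_sub_highPart_le {ρ : ℂ} (h0 : 0 < ρ.re) (h1 : ρ.re < 1) (hγ : ρ.im ≠ 0)
    (hγh : Real.cosh (h / 2) ≤ |ρ.im| * h) :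
    ‖weilMellin (weilConv g (weilReflect g)) ρ -
        weilMellin (weilConv (g + fun t => (-1) * weilConv g (crMoll h m) t)
          (weilReflect (g + fun t => (-1) * weilConv g (crMoll h m) t))) ρ‖ ≤
      6 * b * Real.exp b * weilNorm2Sq g * (Real.cosh (h / 2) / h) ^ (2 * (m + 1)) / |ρ.im| ^ (2 * (m + 1)) := by
  have hv := isWeilTest_highPart hg hh m
  set P : ℂ → ℂ := fun s => sinhc ((s - 1 / 2) * h) ^ (2 * (m + 1)) with hP
  rw [weilMellin_weilQuadratic hg, weilMellin_weilQuadratic hv, weilMellin_highPart hg hh m,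
    weilMellin_highPart hg hh m]
  have e : weilMellin g ρ * conj (weilMellin g (1 - conj ρ)) -
      weilMellin g ρ * (1 - sinhc ((ρ - 1 / 2) * h) ^ (2 * (m + 1))) *
        conj (weilMellin g (1 - conj ρ) * (1 - sinhc ((1 - conj ρ - 1 / 2) * h) ^ (2 * (m + 1)))) =
      weilMellin g ρ * conj (weilMellin g (1 - conj ρ)) *
        (P ρ + conj (P (1 - conj ρ)) - P ρ * conj (P (1 - conj ρ))) := by
    simp only [hP, map_mul, map_sub, map_one]
    ring
  rw [e, norm_mul, norm_mul, Complex.norm_conj]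
  -- the two `ĝ` factors
  have hρ : ρ = (ρ - 1 / 2) + 1 / 2 := by ring
  have hρ' : (1 - conj ρ) = (1 / 2 - conj ρ) + 1 / 2 := by ring
  have e1 : ‖weilMellin g ρ‖ ≤ Real.exp (b / 2) * weilNorm1 g := by
    rw [hρ]
    refine (norm_weilMellin_add_half_le hg hsupp _).trans (mul_le_mul_of_nonneg_right ?_ (weilNorm1_nonneg g))
    rw [Real.exp_le_exp, show (ρ - 1 / 2 : ℂ).re = ρ.re - 1 / 2 by simp]
    have : |ρ.re - 1 / 2| ≤ 1 / 2 := abs_le.2 ⟨by linarith, by linarith⟩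
    nlinarith
  have e2 : ‖weilMellin g (1 - conj ρ)‖ ≤ Real.exp (b / 2) * weilNorm1 g := by
    rw [hρ']
    refine (norm_weilMellin_add_half_le hg hsupp _).trans (mul_le_mul_of_nonneg_right ?_ (weilNorm1_nonneg g))
    rw [Real.exp_le_exp, show (1 / 2 - conj ρ : ℂ).re = 1 / 2 - ρ.re by simp]
    have : |1 / 2 - ρ.re| ≤ 1 / 2 := abs_le.2 ⟨by linarith, by linarith⟩
    nlinarith
  -- the mollifier factors
  have hc : ∀ β : ℝ, |β - 1 / 2| ≤ 1 / 2 → Real.cosh ((β - 1 / 2) * h) ≤ Real.cosh (h / 2) := by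
    intro β hβ
    rw [Real.cosh_le_cosh, abs_mul, abs_of_pos hh]
    have : |h / 2| = h / 2 := abs_of_pos (by linarith)
    rw [this]
    nlinarith
  have hγpos : 0 < |ρ.im| := abs_pos.2 hγ
  set E : ℝ := (Real.cosh (h / 2) / (|ρ.im| * h)) ^ (2 * (m + 1)) with hE
  have hE0 : 0 ≤ E := by positivity
  have hE1 : E ≤ 1 := by
    refine pow_le_one₀ (by positivity) ?_
    rwa [div_le_one (by positivity)]
  have f1 : ‖P ρ‖ ≤ E := by
    have e : ρ = (ρ.re : ℂ) + (ρ.im : ℂ) * I := (Complex.re_add_im ρ).symm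
    have := norm_weilMellin_crMoll_le hh (β := ρ.re) hγ m
    rw [← e, weilMellin_crMoll hh] at this
    refine this.trans (pow_le_pow_left₀ (by positivity) ?_ _)
    exact div_le_div_of_nonneg_right (hc ρ.re (abs_le.2 ⟨by linarith, by linarith⟩)) (by positivity)
  have f2 : ‖P (1 - conj ρ)‖ ≤ E := by
    have e : (1 - conj ρ) = ((1 - ρ.re : ℝ) : ℂ) + (ρ.im : ℂ) * I := by
      apply Complex.ext <;> simp
    have := norm_weilMellin_crMoll_le hh (β := 1 - ρ.re) hγ m
    rw [← e, weilMellin_crMoll hh] at this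
    refine this.trans (pow_le_pow_left₀ (by positivity) ?_ _)
    refine div_le_div_of_nonneg_right ?_ (by positivity)
    have := hc (1 - ρ.re) (abs_le.2 ⟨by linarith, by linarith⟩)
    rwa [show (1 - ρ.re - 1 / 2) = -(ρ.re - 1 / 2) by ring, neg_mul, Real.cosh_neg] at this ⊢
  have f3 : ‖P ρ + conj (P (1 - conj ρ)) - P ρ * conj (P (1 - conj ρ))‖ ≤ 3 * E := by
    refine (norm_sub_le _ _).trans ?_
    refine (add_le_add (norm_add_le _ _) le_rfl).trans ?_
    rw [norm_mul, Complex.norm_conj]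
    have : ‖P ρ‖ * ‖P (1 - conj ρ)‖ ≤ E * 1 := mul_le_mul f1 (f2.trans hE1) (norm_nonneg _) hE0
    linarith
  -- assemble
  have hL1 : weilNorm1 g ^ 2 ≤ 2 * b * weilNorm2Sq g := weilNorm1_sq_le hg hb hsupp
  have hA : 0 ≤ Real.exp (b / 2) * weilNorm1 g := mul_nonneg (Real.exp_pos _).le (weilNorm1_nonneg g)
  have hEeq : E = (Real.cosh (h / 2) / h) ^ (2 * (m + 1)) / |ρ.im| ^ (2 * (m + 1)) := by
    rw [hE, show Real.cosh (h / 2) / (|ρ.im| * h) = Real.cosh (h / 2) / h / |ρ.im| by rw [div_div, mul_comm], div_pow]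
  calc ‖weilMellin g ρ‖ * ‖weilMellin g (1 - conj ρ)‖ * ‖P ρ + conj (P (1 - conj ρ)) - P ρ * conj (P (1 - conj ρ))‖
      ≤ (Real.exp (b / 2) * weilNorm1 g) * (Real.exp (b / 2) * weilNorm1 g) * (3 * E) :=
        mul_le_mul (mul_le_mul e1 e2 (norm_nonneg _) hA) f3 (norm_nonneg _) (mul_nonneg hA hA)
    _ = Real.exp (b / 2) ^ 2 * weilNorm1 g ^ 2 * (3 * E) := by ring
    _ ≤ Real.exp (b / 2) ^ 2 * (2 * b * weilNorm2Sq g) * (3 * E) :=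
        mul_le_mul_of_nonneg_right (mul_le_mul_of_nonneg_left hL1 (sq_nonneg _)) (by positivity)
    _ = 6 * b * Real.exp b * weilNorm2Sq g * (Real.cosh (h / 2) / h) ^ (2 * (m + 1)) / |ρ.im| ^ (2 * (m + 1)) := by
        rw [hEeq, ← Real.exp_nat_mul]; ring_nf

/-- **Non-negativity of `Ĝ − V̂` on the critical line**: `Re (Ĝ − V̂)(½+iγ) = |ĝ|² (1 − (1 − sinc^{2(m+1)})²) ≥ 0`. [folklore] -/
theorem re_weilMellin_quadratic_sub_highPart_nonneg {ρ : ℂ} (hre : ρ.re = 1 / 2) :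
    0 ≤ (weilMellin (weilConv g (weilReflect g)) ρ -
        weilMellin (weilConv (g + fun t => (-1) * weilConv g (crMoll h m) t)
          (weilReflect (g + fun t => (-1) * weilConv g (crMoll h m) t))) ρ).re := by
  have hv := isWeilTest_highPart hg hh m
  have eρ : ρ = 1 / 2 + (ρ.im : ℂ) * I := by
    apply Complex.ext <;> simp [hre]
  rw [weilMellin_weilQuadratic_of_re_eq hg hre, weilMellin_weilQuadratic_of_re_eq hv hre, Complex.sub_re,
    Complex.ofReal_re, Complex.ofReal_re, Complex.normSq_eq_norm_sq, Complex.normSq_eq_norm_sq, eρ,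
    norm_sq_weilMellin_highPart hg hh m]
  set s : ℝ := Real.sinc (ρ.im * h) ^ (2 * (m + 1)) with hs
  have hs0 : 0 ≤ s := by rw [hs, pow_mul]; positivity
  have hs1 : s ≤ 1 := (norm_weilMellin_crMoll_half_line hh ρ.im m).2
  have h01 : (1 - s) ^ 2 ≤ 1 := by nlinarith
  nlinarith [sq_nonneg ‖weilMellin g (1 / 2 + ρ.im * I)‖, mul_le_mul_of_nonneg_left h01 (sq_nonneg ‖weilMellin g (1 / 2 + ρ.im * I)‖)]

end HighPart

/-! ### Theorem A′ -/

section TheoremA'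

variable {g : ℝ → ℂ} (hg : IsWeilTest g) {b : ℝ} (hb : 0 < b) (hsupp : tsupport g ⊆ Icc (-b) b)
  {h : ℝ} (hh : 0 < h) {m : ℕ} {b' : ℝ} (hbb : b + 2 * (m + 1) * h ≤ b')
  {H Θ : ℝ} (hH : 1 ≤ H) (hRH : RiemannHypothesisInStripUpTo H) (hΘ : tailInvImSq H ≤ Θ)
  (hHh : Real.cosh (h / 2) ≤ h * H)
  {N' : ℕ} {A : ℝ → ℝ} (hA : IsArchDensity b' N' A)
  {Pup : ℝ} (hP0 : 0 ≤ Pup)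
  (hKT : ∀ v : ℝ → ℂ, IsWeilTest v → tsupport v ⊆ Icc (-b') b' →
    ∑ n ∈ Finset.range (N' + 1), 2 * Λ n / Real.sqrt n * ((weilConv v (weilReflect v)) (Real.log n)).re ≤
      Pup * weilNorm2Sq v)
  {Y B : ℝ} (hY : 0 ≤ Y) (hhY : h * Y ≤ 1) (hB : 0 ≤ B)
  (hHF : ∀ y : ℝ, Y < |y| → Pup + 1 ≤ A y) (hLB : ∀ y : ℝ, |y| ≤ Y → -B ≤ A y)
  (hN1 : 6 * b * Real.exp b * (Real.cosh (h / 2) / h) ^ (2 * (m + 1)) / H ^ (2 * (m + 1) - 2) * Θ +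
      ((m + 1) * (h * Y) ^ 2 / 3) ^ 2 * (B + Pup + 1) ≤ 1)
include hg hb hsupp hh hbb hH hRH hΘ hHh hA hP0 hKT hY hhY hB hHF hLB hN1

/-- **Theorem A′ — Weil's functional with unit slack from numerical RH, Krein–Turán form** (abstract): under
`RiemannHypothesisInStripUpTo H`, an arch density `A` at cutoff `b′ ≥ b + 2(m+1)h` with `A ≥ Π + 1` beyond `|y| > Y` and
`A ≥ −B` below, a Krein–Turán bound `Π` for the honest comb on `[-b′, b′]`, and the numerical side condition
`τ′ + δ′(B + Π + 1) ≤ 1`, every Weil test `g` supported in `[-b, b]` satisfies `0 ≤ Re W(g ⋆ g̃) + ‖g‖₂²` (unit slack, written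
as a non-negativity so as not to shadow the conclusion of Theorem A). [folklore] -/
theorem unitSlackWeil_of_rhUpTo_kreinTuran : 0 ≤ (weilFunctional (weilConv g (weilReflect g))).re + weilNorm2Sq g := by
  -- notation
  set τc : ℝ := 6 * b * Real.exp b * (Real.cosh (h / 2) / h) ^ (2 * (m + 1)) / H ^ (2 * (m + 1) - 2) * Θ with hτc
  set δ : ℝ := ((m + 1) * (h * Y) ^ 2 / 3) ^ 2 with hδ
  have hδ0 : 0 ≤ δ := by positivity
  have hΘ0 : 0 ≤ Θ := (tailInvImSq_nonneg H).trans hΘ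
  have hτ0 : 0 ≤ τc := by positivity
  set v : ℝ → ℂ := g + fun t => (-1) * weilConv g (crMoll h m) t with hv_def
  have hv : IsWeilTest v := isWeilTest_highPart hg hh m
  have hvs : tsupport v ⊆ Icc (-b') b' :=
    (tsupport_highPart_subset hg hsupp hh m).trans (Icc_subset_Icc (by linarith) hbb)
  set ρ : ℝ → ℝ := fun y => ‖weilMellin g (1 / 2 + y * I)‖ ^ 2 with hρ
  set t : ℝ → ℝ := fun y => (1 - Real.sinc (y * h) ^ (2 * (m + 1))) ^ 2 with ht
  have ht01 : ∀ y, 0 ≤ t y ∧ t y ≤ 1 := fun y => by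
    have hs0 : 0 ≤ Real.sinc (y * h) ^ (2 * (m + 1)) := by rw [pow_mul]; positivity
    have hs1 := (norm_weilMellin_crMoll_half_line hh y m).2
    refine ⟨sq_nonneg _, ?_⟩
    simp only [ht]
    nlinarith
  have htflat : ∀ y, |y| ≤ Y → t y ≤ δ := fun y hy => by
    have hu : |y * h| ≤ 1 := by
      rw [abs_mul, abs_of_pos hh]
      calc |y| * h ≤ Y * h := mul_le_mul_of_nonneg_right hy hh.le
        _ ≤ 1 := by linarith [mul_comm h Y]
    have h1 := one_sub_sinc_pow_le hu m
    have h0 : 0 ≤ 1 - Real.sinc (y * h) ^ (2 * (m + 1)) := sub_nonneg.2 (norm_weilMellin_crMoll_half_line hh y m).2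
    have h2 : (m + 1) * (y * h) ^ 2 / 3 ≤ (m + 1) * (h * Y) ^ 2 / 3 := by
      have : (y * h) ^ 2 ≤ (h * Y) ^ 2 := by
        rw [← sq_abs (y * h), ← sq_abs (h * Y)]
        refine pow_le_pow_left₀ (abs_nonneg _) ?_ 2
        rw [abs_mul, abs_mul, abs_of_pos hh, abs_of_nonneg hY]
        nlinarith [abs_nonneg y]
      have hm : (0 : ℝ) ≤ m + 1 := by positivity
      nlinarith
    simp only [ht, hδ]
    exact pow_le_pow_left₀ h0 (h1.trans h2) 2
  have hρv : ∀ y : ℝ, ‖weilMellin v (1 / 2 + y * I)‖ ^ 2 = ρ y * t y := fun y =>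
    norm_sq_weilMellin_highPart hg hh m y
  -- Plancherel for g and v
  have hPl : weilNorm2Sq g = 1 / (2 * π) * ∫ y, ρ y := by
    rw [hρ, integral_norm_sq_weilMellin_half_line hg]; field_simp
  have hPlv : weilNorm2Sq v = 1 / (2 * π) * ∫ y, ρ y * t y := by
    have := integral_norm_sq_weilMellin_half_line hv
    simp only [hρv] at this
    rw [this]; field_simp
  -- the zero side: Re W(G) − Re W(V) ≥ −τ′ ‖g‖²
  set Kc : ℝ := 6 * b * Real.exp b * weilNorm2Sq g * (Real.cosh (h / 2) / h) ^ (2 * (m + 1)) with hKc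
  have hK0 : 0 ≤ Kc := by have := weilNorm2Sq_nonneg g; positivity
  have hτK : τc * weilNorm2Sq g = Kc / H ^ (2 * (m + 1) - 2) * Θ := by rw [hτc, hKc]; ring
  have hzero : -(τc * weilNorm2Sq g) ≤ (weilFunctional (weilConv g (weilReflect g))).re -
      (weilFunctional (weilConv v (weilReflect v))).re := by
    have hk : 2 ≤ 2 * (m + 1) := by omega
    have hlf := re_weilFunctional_sub_ge_of_rhUpTo (hg.weilConv hg.weilReflect) (hv.weilConv hv.weilReflect) hH hRH hK0 hk
      (fun z _ hre => re_weilMellin_quadratic_sub_highPart_nonneg hg hh m hre)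
      (fun z _ h0 h1 hzH => norm_weilMellin_quadratic_sub_highPart_le hg hb hsupp hh m h0 h1
        (fun him => by rw [him, abs_zero] at hzH; linarith)
        (hHh.trans (by nlinarith [hzH.le, hh.le])))
    refine le_trans ?_ hlf
    rw [hτK, neg_le_neg_iff]
    exact mul_le_mul_of_nonneg_left hΘ (by positivity)
  -- the arch side for v
  obtain ⟨hIv, hSv⟩ := hA v hv hvs
  have hKTv := hKT v hv hvs
  simp only [hρv] at hIv hSv
  -- integrability bookkeeping
  have hI1 : Integrable ρ := integrable_norm_sq_weilMellin_half_line hg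
  have hI2 : Integrable fun y => ρ y * t y := by
    have := integrable_norm_sq_weilMellin_half_line hv
    simpa only [hρv] using this
  have h12 : Integrable fun y => ρ y * t y * A y - (Pup + 1) * (ρ y * t y) := hIv.sub (hI2.const_mul _)
  have h123 : Integrable fun y => ρ y * t y * A y - (Pup + 1) * (ρ y * t y) + (1 - τc) * ρ y :=
    h12.add (hI1.const_mul _)
  -- pointwise lower bound of the combined density
  have hpt : ∀ y, 0 ≤ ρ y * t y * A y - (Pup + 1) * (ρ y * t y) + (1 - τc) * ρ y := by
    intro y
    have hρ0 : 0 ≤ ρ y := sq_nonneg _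
    obtain ⟨ht0, ht1⟩ := ht01 y
    have e : ρ y * t y * A y - (Pup + 1) * (ρ y * t y) + (1 - τc) * ρ y =
        ρ y * (t y * (A y - (Pup + 1)) + (1 - τc)) := by ring
    rw [e]
    refine mul_nonneg hρ0 ?_
    have hτ1 : τc ≤ 1 := by nlinarith
    rcases le_or_gt |y| Y with hy | hy
    · have h1 := htflat y hy
      have hAy := hLB y hy
      have p1 : -(δ * (B + Pup + 1)) ≤ t y * (A y - (Pup + 1)) := by
        have q1 : t y * (-(B + Pup + 1)) ≤ t y * (A y - (Pup + 1)) :=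
          mul_le_mul_of_nonneg_left (by linarith) ht0
        have q2 : t y * (B + Pup + 1) ≤ δ * (B + Pup + 1) :=
          mul_le_mul_of_nonneg_right h1 (by linarith)
        linarith
      linarith
    · have p1 : 0 ≤ t y * (A y - (Pup + 1)) := mul_nonneg ht0 (by linarith [hHF y hy])
      linarith
  have hmain : 0 ≤ ∫ y, ρ y * t y * A y - (Pup + 1) * (ρ y * t y) + (1 - τc) * ρ y := integral_nonneg hpt
  rw [integral_add h12 (hI1.const_mul _), integral_sub hIv (hI2.const_mul _), integral_const_mul,
    integral_const_mul] at hmain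
  -- combine
  set IA := ∫ y, ρ y * t y * A y with hIA
  set It := ∫ y, ρ y * t y with hIt
  set Iρ := ∫ y, ρ y with hIρ
  set c : ℝ := 1 / (2 * π) with hc
  have hcpos : 0 < c := by positivity
  have hm2 : 0 ≤ c * IA - Pup * (c * It) - c * It + (c * Iρ) - τc * (c * Iρ) := by
    have e2 : c * (IA - (Pup + 1) * It + (1 - τc) * Iρ) = c * IA - Pup * (c * It) - c * It + (c * Iρ) - τc * (c * Iρ) := by
      ring
    rw [← e2]; exact mul_nonneg hcpos.le hmain
  rw [hPlv] at hSv hKTv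
  rw [hPl] at hzero ⊢
  linarith

end TheoremA'

end Summit.RiemannHypothesis.RiemannHypothesis.Theorems.SignCone

end
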